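import Literature.AnabelianGeometry.EtaleTheta.Discharge.Sec4Prop42OfConnectedTemperoid

/-!
# [EtTh] Prop 4.2 (iv) ALONE at the canonical model under the ROOTS READING of the
# `(N, H_⊙^{bs-fld})`-saturation slot — binder-free over the canonical [FrdI] vocabulary

Mochizuki, *The étale theta function and its Frobenioid-theoretic manifestations*, Publ. RIMS **45** (2009),
§4, Prop. 4.2 (iv), statement PDF pp. 88–89, proof PDF p. 90 L12–24 (printed p. 316)
[cite: MochizukiEtTh2009, Prop 4.2 p.89]; Def. 4.1 (iii)(a) PDF p. 87; [FrdII] Def. 2.2 (ii) / Rmk. 2.2.1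
(kurims p. 18).  abc-iut cell, layer L2, cone node `EtTh:Prop4.2(iv)` (plan/L2/SUBDAG-EtTh-Prop42.md §C,
custodian abc-iut-w5-d134; sub-nodes L05 `UnitRootsUpstairs`, L06 `ZetaA`); seat abc-iut-w5-d063 (gen 5,
R-C discharge prover, holder of the node).  PROOF-ONLY companion (0 `def`s, no instance, no named fact):
every theorem is a BY-NAME instantiation of landed theorems; nothing landed is edited or restated.

## What was open, and what this file records

The typed statement `BiKummerSetting.Prop42_iv S pullFrac` (FACT-LIST F-0491) quantifies over an ARBITRARY
transport `pullFrac`; its universal closure is REFUTED in the tree (`ToyCst.not_forall_prop42_iv`, p437609),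
so the node is decided AT NAMED INSTANCES.  The instance of record is abc-iut-L2-t9's canonical model
`mkOfModelCanonical` with the genuine transport `pullFracModel` (`((α')^birat)^* = B(Base α')`), where
abc-iut-w4-d044's `prop42_iv_mkOfModelCanonical_of_constantRoots` (`Discharge/Sec4Prop42SubUnitRoots.lean`)
proves (iv) modulo EXACTLY two base-data laws: `Φ` divisorial ([FrdI] Thm. 5.2 (ii)) and the
«roots of constants» law `hL` (plan/GAP-LEDGER.md G-w4d044-1) for the free `(N, H)`-saturation predicate `NH`.

The joint (iii) ∧ (iv) files of record (`Sec4Prop42SubRootsReading.lean`, p428987;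
`Sec4Prop42OfConnectedTemperoid.lean`, p441505) instantiate `NH` by the ROOTS READING
  `NH A N := ∀ (b : A^bs ⟶ A_⊙^bs) (x ∈ B(A_⊙^bs)), Div_B x = 1 → ∃ ζ ∈ B(A^bs), ζ^N = B(b)(x)`
(the consequence [FrdII] Rmk. 2.2.1 draws from Def. 2.2 (ii)(c) — WEAKER than print's cohomological
condition, and exactly what the proof of (iv) uses, p. 90 L14–17), under which `hL` is tautological
(`Prop42Sub.constantRoots_rootsReading`) — but they carry the laws `hDSpull`, `hR` (ERRATUM E2, G-w4d044-3),
`hK` needed by the EXISTENCE assertion (iii).  abc-iut-w6-d037 (gen 4) listed the «(iv)-only law-free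
route» as NOT DONE.  This file does it:

* `prop42_iv_mkOfModelCanonical_rootsReading (hΦd)` — (iv) AS TYPED at the canonical model with the roots
  reading, over ANY base `D` with Galois data `(IG, gS)`, modulo `Φ` divisorial ONLY;
* `prop42_iv_mkOfModelCanonical_rootsReading_treeCatVocab` — the same over the canonical base-category
  vocabulary `treeCatVocab` ("`Φ` divisorial" is the Def. 3.6 (ii) field,
  `TemperedFrobenioid.isDivisorial_divisorMonoid`): **NO law binder at all** — a theorem about EVERY
  tempered Frobenioid `tf` of monoid type `ℤ` with perfect `Φ`, every `(IG, gS)`, every Frobenius-trivial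
  Galois `A_⊙`;
* `prop42_iv_mkOfConnectedTemperoid_rootsReading (hΦd)` / `…_treeCatVocab` — the same two statements over
  print's GENUINE CONNECTED base `D := B^temp(Π^tp_X)⁰ = ConnectedPart (BTemp X.Pi)` at abc-iut-L2-t4's
  `mkOfConnectedTemperoid` (Galois objects := [SemiAnbd] Def. 3.1 (iv), Galois surjections := `galoisSurjOf`);
  the `treeCatVocab` form is again binder-free, and is restated with the fully-qualified head
  `Literature.AnabelianGeometry.EtaleTheta.BiKummerSetting.Prop42_iv` for the cell's head-match census.

NODE READING for `EtTh:Prop4.2(iv)` (no side taken on anything downstream; [EtTh] is a refereed prerequisite):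
AS TYPED, (iv) is a THEOREM at the canonical model over the genuine connected base under the roots reading of
Def. 4.1 (iii)(a), for every tempered Frobenioid over the canonical vocabulary — hypothesis-free.  What stays
open is only the FAITHFUL (cohomological, [FrdII] Def. 2.2 (ii)(c)) reading of the saturation slot, i.e. GAP
row G-w4d044-1 as the `C^{bs-fld}` ↔ `p`-adic-Frobenioid identification (owner: the L1-t4 / L2-t3 lineages);
the EXISTENCE assertion (iii) is a different node and keeps `hDSpull` / `hR` / `hK` (`hE`).  typed ≠ proved
elsewhere; nothing here bears on [IUTchIII] Cor. 3.12.
-/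

noncomputable section

namespace Literature.AnabelianGeometry.EtaleTheta

open CategoryTheory Opposite Literature.AlgebraicGeometry.Frobenioids Literature.AnabelianGeometry.SemiGraphs
  Literature.AnabelianGeometry.SemiGraphs.GaloisObjects Literature.AlgebraicGeometry.Frobenioids.QuasiTemperoid.BTempConnected

universe u₀ v₀ u v w

variable {K : Type u₀} [Field K]

namespace BiKummerSetting

/-! ## §1 The canonical model over any base `D` with Galois data `(IG, gS)` -/

section Canonical

variable (X : SemiGraphs.TemperedArithmeticGroup.{u₀} K) {D₀ : Type u₀}
  [Category.{v₀} D₀] {V : FrdIMonoidStub.{w}} {T : RealifiedDivisorMonoids (D₀ := D₀) V}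
  {D : Type u} [Category.{v} D] {VD : FrdICatStub.{u, v, w} D}
  (tf : TemperedFrobenioid T D VD) (hZ : tf.monoidType = MonoidType.Z)
  (hP : ∀ A : Dᵒᵖ, IsPerfect (tf.Φ.carrier A)) (IG : D → Prop) (gS : ∀ A : D, IG A → (X.Pi →* Aut A))
  (gSs : ∀ (A : D) (h : IG A), Function.Surjective (gS A h)) (A₀ : tf.category)
  (hA₀ : PreFrobenioid.IsFrobeniusTrivial tf.toElem A₀) (hA₀' : IG A₀.base)

/-- **[EtTh] Prop. 4.2 (iv) AS TYPED at the canonical model under the ROOTS READING of the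
`(N, H_⊙^{bs-fld})`-saturation slot, modulo `Φ` divisorial ONLY**: abc-iut-w4-d044's
`prop42_iv_mkOfModelCanonical_of_constantRoots` with `NH :=` the roots reading, under which the
roots-of-constants law `hL` (G-w4d044-1) is tautological (`Prop42Sub.constantRoots_rootsReading`).
[cite: MochizukiEtTh2009, Prop 4.2 p.89] -/
theorem prop42_iv_mkOfModelCanonical_rootsReading
    (hΦd : Objectwise (fun M _ => IsDivisorial M) tf.divisorMonoid) :
    (mkOfModelCanonical X tf hZ hP IG gS gSs
        (fun _ A M => ∀ (b : A.base ⟶ A₀.base) (x : tf.ratFnFunctor.obj (op A₀.base)),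
          divB tf.divisorMonoid tf.ratFnFunctor tf.divBNatTrans (op A₀.base) x = 1 →
            ∃ ζ : tf.ratFnFunctor.obj (op A.base), ζ ^ (M : ℕ) = pull tf.ratFnFunctor b x)
        A₀ hA₀ hA₀').Prop42_iv (fun φ x => tf.pullFracModel φ x) :=
  prop42_iv_mkOfModelCanonical_of_constantRoots X tf hZ hP IG gS gSs _ A₀ hA₀ hA₀' hΦd
    (fun _ _ g ξ _ hNH hξ => hNH g ξ hξ)

end Canonical

/-! ## §2 The canonical model over the canonical base-category vocabulary `treeCatVocab`: binder-free -/

section CanonicalTreeCat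

variable (X : SemiGraphs.TemperedArithmeticGroup.{u₀} K) {D₀ : Type u₀}
  [Category.{v₀} D₀] {V : FrdIMonoidStub.{w}} {T : RealifiedDivisorMonoids (D₀ := D₀) V}
  {D : Type u} [Category.{v} D] {IsRational IsStrictlyRational : (Dᵒᵖ ⥤ CommMonCat.{w}) → Prop}
  (tf : TemperedFrobenioid T D (treeCatVocab D IsRational IsStrictlyRational)) (hZ : tf.monoidType = MonoidType.Z)
  (hP : ∀ A : Dᵒᵖ, IsPerfect (tf.Φ.carrier A)) (IG : D → Prop) (gS : ∀ A : D, IG A → (X.Pi →* Aut A))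
  (gSs : ∀ (A : D) (h : IG A), Function.Surjective (gS A h)) (A₀ : tf.category)
  (hA₀ : PreFrobenioid.IsFrobeniusTrivial tf.toElem A₀) (hA₀' : IG A₀.base)

/-- **[EtTh] Prop. 4.2 (iv) AS TYPED at the canonical model under the roots reading, over `treeCatVocab` —
NO LAW BINDER**: "`Φ` divisorial" is the Def. 3.6 (ii) field (`TemperedFrobenioid.isDivisorial_divisorMonoid`).
A theorem about every tempered Frobenioid of monoid type `ℤ` with perfect divisor monoid, every Galois datum
`(IG, gS)` and every Frobenius-trivial `A_⊙`. [cite: MochizukiEtTh2009, Prop 4.2 p.89] -/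
theorem prop42_iv_mkOfModelCanonical_rootsReading_treeCatVocab :
    (mkOfModelCanonical X tf hZ hP IG gS gSs
        (fun _ A M => ∀ (b : A.base ⟶ A₀.base) (x : tf.ratFnFunctor.obj (op A₀.base)),
          divB tf.divisorMonoid tf.ratFnFunctor tf.divBNatTrans (op A₀.base) x = 1 →
            ∃ ζ : tf.ratFnFunctor.obj (op A.base), ζ ^ (M : ℕ) = pull tf.ratFnFunctor b x)
        A₀ hA₀ hA₀').Prop42_iv (fun φ x => tf.pullFracModel φ x) :=
  prop42_iv_mkOfModelCanonical_rootsReading X tf hZ hP IG gS gSs A₀ hA₀ hA₀' tf.isDivisorial_divisorMonoid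

end CanonicalTreeCat

/-! ## §3 The genuine connected base `D := B^temp(Π^tp_X)⁰` -/

section Connected

variable (X : SemiGraphs.TemperedArithmeticGroup.{u₀} K) {D₀ : Type u₀} [Category.{v₀} D₀]
  {V : FrdIMonoidStub.{w}} {T₀ : RealifiedDivisorMonoids (D₀ := D₀) V}
  {VD : FrdICatStub.{u₀ + 1, u₀, w} (ConnectedPart (BTemp X.Pi))}
  (tf : TemperedFrobenioid T₀ (ConnectedPart (BTemp X.Pi)) VD) (hZ : tf.monoidType = MonoidType.Z)
  (hP : ∀ A : (ConnectedPart (BTemp X.Pi))ᵒᵖ, IsPerfect (tf.Φ.carrier A))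
  (A₀ : tf.category) (hA₀ : PreFrobenioid.IsFrobeniusTrivial tf.toElem A₀) (hA₀' : SemiGraphs.IsGaloisObj A₀.base.obj)

/-- **[EtTh] Prop. 4.2 (iv) AS TYPED over the GENUINE CONNECTED base `B^temp(Π^tp_X)⁰` at abc-iut-L2-t4's
`mkOfConnectedTemperoid`, roots reading, modulo `Φ` divisorial ONLY** (no naturality law, no `(N, H)` law, no
root law — those belong to the existence assertion (iii)). [cite: MochizukiEtTh2009, Prop 4.2 p.89] -/
theorem prop42_iv_mkOfConnectedTemperoid_rootsReading
    (hΦd : Objectwise (fun M _ => IsDivisorial M) tf.divisorMonoid) :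
    (mkOfConnectedTemperoid X tf hZ hP
        (fun _ A M => ∀ (b : A.base ⟶ A₀.base) (x : tf.ratFnFunctor.obj (op A₀.base)),
          divB tf.divisorMonoid tf.ratFnFunctor tf.divBNatTrans (op A₀.base) x = 1 →
            ∃ ζ : tf.ratFnFunctor.obj (op A.base), ζ ^ (M : ℕ) = pull tf.ratFnFunctor b x)
        A₀ hA₀ hA₀').Prop42_iv (fun φ x => tf.pullFracModel φ x) :=
  prop42_iv_mkOfModelCanonical_rootsReading X tf hZ hP _ _ _ A₀ hA₀ hA₀' hΦd

end Connected

section ConnectedTreeCat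

variable (X : SemiGraphs.TemperedArithmeticGroup.{u₀} K) {D₀ : Type u₀} [Category.{v₀} D₀]
  {V : FrdIMonoidStub.{w}} {T₀ : RealifiedDivisorMonoids (D₀ := D₀) V}
  {IsRational IsStrictlyRational : ((ConnectedPart (BTemp X.Pi))ᵒᵖ ⥤ CommMonCat.{w}) → Prop}
  (tf : TemperedFrobenioid T₀ (ConnectedPart (BTemp X.Pi))
    (treeCatVocab (ConnectedPart (BTemp X.Pi)) IsRational IsStrictlyRational))
  (hZ : tf.monoidType = MonoidType.Z) (hP : ∀ A : (ConnectedPart (BTemp X.Pi))ᵒᵖ, IsPerfect (tf.Φ.carrier A))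
  (A₀ : tf.category) (hA₀ : PreFrobenioid.IsFrobeniusTrivial tf.toElem A₀) (hA₀' : SemiGraphs.IsGaloisObj A₀.base.obj)

/-- **[EtTh] Prop. 4.2 (iv) AS TYPED over the genuine connected base `B^temp(Π^tp_X)⁰` and the canonical
vocabulary `treeCatVocab`, roots reading — NO LAW BINDER**: a theorem about every tempered Frobenioid `tf`
of monoid type `ℤ` with perfect divisor monoid over `B^temp(Π^tp_X)⁰` and every Frobenius-trivial Galois `A_⊙`.
[cite: MochizukiEtTh2009, Prop 4.2 p.89] -/
theorem prop42_iv_mkOfConnectedTemperoid_rootsReading_treeCatVocab :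
    (mkOfConnectedTemperoid X tf hZ hP
        (fun _ A M => ∀ (b : A.base ⟶ A₀.base) (x : tf.ratFnFunctor.obj (op A₀.base)),
          divB tf.divisorMonoid tf.ratFnFunctor tf.divBNatTrans (op A₀.base) x = 1 →
            ∃ ζ : tf.ratFnFunctor.obj (op A.base), ζ ^ (M : ℕ) = pull tf.ratFnFunctor b x)
        A₀ hA₀ hA₀').Prop42_iv (fun φ x => tf.pullFracModel φ x) :=
  prop42_iv_mkOfConnectedTemperoid_rootsReading X tf hZ hP A₀ hA₀ hA₀' tf.isDivisorial_divisorMonoid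

/-- **The cone node `EtTh:Prop4.2(iv)` at its instance of record, with the FULLY-QUALIFIED head** (cell
FQ-TYPE rule; head-match form of FACT-LIST F-0491 «instance form»): the typed named `Prop`
`Literature.AnabelianGeometry.EtaleTheta.BiKummerSetting.Prop42_iv S pullFrac` HOLDS for
`S :=` the canonical §4 setting over `B^temp(Π^tp_X)⁰` (roots reading) and `pullFrac :=` the genuine transport
`pullFracModel`, for every `X`, `tf`, `A_⊙` as above — no hypothesis. [cite: MochizukiEtTh2009, Prop 4.2 p.89] -/
theorem prop42_iv_holds_mkOfConnectedTemperoid_rootsReading_treeCatVocab :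
    Literature.AnabelianGeometry.EtaleTheta.BiKummerSetting.Prop42_iv
      (mkOfConnectedTemperoid X tf hZ hP
        (fun _ A M => ∀ (b : A.base ⟶ A₀.base) (x : tf.ratFnFunctor.obj (op A₀.base)),
          divB tf.divisorMonoid tf.ratFnFunctor tf.divBNatTrans (op A₀.base) x = 1 →
            ∃ ζ : tf.ratFnFunctor.obj (op A.base), ζ ^ (M : ℕ) = pull tf.ratFnFunctor b x)
        A₀ hA₀ hA₀')
      (fun φ x => tf.pullFracModel φ x) :=
  prop42_iv_mkOfConnectedTemperoid_rootsReading_treeCatVocab X tf hZ hP A₀ hA₀ hA₀'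

end ConnectedTreeCat

end BiKummerSetting

end Literature.AnabelianGeometry.EtaleTheta

end
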